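import Summits.AtomisticToContinuum.BoseEinsteinCondensation.Theorems.InfraredMinimumUncertainty.Negative.LadderFrames
import Summits.AtomisticToContinuum.BoseEinsteinCondensation.Theorems.BECConjugateDominationInfraredMinimumUncertaintyTiltReflection

/-!
# Crux `InfraredMinimumUncertainty` (stmt-AtomisticToContinuum-11784), line `tilted-coherence-work-variance`:
# the eigenstructure hypotheses of the transfer stub S34 are LOAD-BEARING (negative side)

Supports (does not close) stmt-AtomisticToContinuum-11784.  The lead's reshape-r2 stub S34
`stub_tiltedUncertaintyHalfTilts` quantifies over EXACT positive minimisers `Ψ` carrying the tilted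
generator identity `TiltedGeneratorIdentityAt v Ψ` (S2's conclusion: `Ψ` and `Ψ∘τ_r` solve the
Schrödinger equation pointwise) and asserts `Π_t(m) ≤ C` for every tilt `t ∈ [0,½]` and mode `m ≠ 0`.
Here we record, sorry-free, that this pair of hypotheses cannot be weakened to `δ`-near-minimisers
(`δ > 0` fixed before `N`) with the generator identity dropped — exactly as for the crux itself
(`not_infraredMinimumUncertaintyNearMinimisers`, Negative/MinimalityLoadBearing):

* `tiltedBody C ρ n Ψ := ∀ m ≠ 0, ∀ t ∈ [0,½], Π_t(m) ≤ C` — S34's body with the generator identity dropped;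
* `TiltedUncertaintyNearMinimisers := FrameNearMinimisers tiltedBody`,
  `TiltedUncertaintyWithoutEigenstructure := FrameWithoutMinimality tiltedBody`;
* `mul_levyWeight_mul_structureFactor_le_of_tilted` — the POINTWISE transfer, kinematic (every
  nowhere-vanishing admissible `Ψ`, `L > 0`): `(∀ t ∈ [0,½], Π_t(m) ≤ C) → N·ν_m·S_m ≤ 2C`, by the landed
  S1 `stub_tiltedLevyIdentity` (`N ν_m S_m = ∫₀¹ 4min(t,1−t)Π_t(m)dt`) and the landed tilt reflection
  `Π_{1−t} = Π_t`;
* `nearMinimisers_imu_of_tilted : TiltedUncertaintyNearMinimisers → InfraredMinimumUncertaintyNearMinimisers`;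
* `not_tiltedUncertaintyNearMinimisers` (registered sub-goal) and
  `tiltedUncertainty_false_without_eigenstructure`: both weakened frames are FALSE — witness the free
  density waves of `MinimalityLoadBearing` (`v ≡ 0`, Bragg peak × phase weight, `Π_{e₀} ≍ (δL²)²`),
  transported through the kinematic transfer.  So any proof of S34 must use the eigen-equations of `Ψ`
  AND `Ψ∘τ_r` (the generator identity) below every `N`-uniform energy resolution; the kinematic part of
  the line (S1, reflection) carries no minimality, consistent with Disproof §C/§H.
-/

noncomputable section

open MeasureTheory Filter Set
open scoped ENNReal NNReal Topology BigOperators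

namespace Summit.AtomisticToContinuum.BoseEinsteinCondensation.Theorems.InfraredMinimumUncertainty.Negative

open Literature.MathematicalPhysics.QuantumManyBody.BoseGas
open Summit.AtomisticToContinuum.BoseEinsteinCondensation.Theses.BECConjugateDomination
  (InfraredMinimumUncertainty)
open Summit.AtomisticToContinuum.BoseEinsteinCondensation.Cruxes.InfraredMinimumUncertainty.FisherGaussianDensityMode
  (InSmoothClass IsPositiveMinimiser coherence levyWeight structureFactor CruxFrame mul_structureFactor_nonneg)
open Summit.AtomisticToContinuum.BoseEinsteinCondensation.Cruxes.InfraredMinimumUncertainty.TiltedCoherenceWorkVariance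
open Summit.AtomisticToContinuum.BoseEinsteinCondensation.Theorems.BECConjugateDomination
  (tiltedProduct_one_sub stub_tiltedLevyIdentity)

variable {n : ℕ} {L : ℝ}

/-! ## S34's body without the generator identity; the two weakened frames -/

/-- S34's body with the generator-identity hypothesis DROPPED: `Π_t(m) ≤ C` for all `m ≠ 0`, `t ∈ [0,½]`. -/
def tiltedBody (C ρ : ℝ) (n : ℕ) (Ψ : PeriodicTrialState (n + 1) (sideLength ρ (n + 1))) : Prop :=
  ∀ m : Fin 3 → ℤ, m ≠ 0 → ∀ t ∈ Set.Icc (0 : ℝ) (1 / 2), tiltedProduct n (sideLength ρ (n + 1)) Ψ t m ≤ C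

/-- S34 for `δ`-NEAR-minimisers (`δ > 0` before `N`), generator identity dropped. A statement (refuted below). -/
def TiltedUncertaintyNearMinimisers : Prop := FrameNearMinimisers tiltedBody

/-- S34 with BOTH eigenstructure hypotheses deleted (minimality and the generator identity; finite energy,
`Ψ = |Ψ| ≠ 0` kept). A statement (refuted below). -/
def TiltedUncertaintyWithoutEigenstructure : Prop := FrameWithoutMinimality tiltedBody

/-! ## The pointwise transfer (kinematic) -/

/-- **Pointwise transfer `Π_t(m) ≤ C ∀ t ∈ [0,½] ⇒ N·ν_m·S_m ≤ 2C`** for every nowhere-vanishing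
admissible `Ψ` on a torus of side `L > 0` (no minimality): the half range extends to `[0,1]` by the tilt
reflection `Π_{1−t} = Π_t`, then S1 (b),(c) give `N ν_m S_m = ∫₀¹ 4min(t,1−t)·Π_t(m) dt ≤ 2C` since
`0 ≤ 4min(t,1−t) ≤ 2`. [folklore] -/
theorem mul_levyWeight_mul_structureFactor_le_of_tilted (hL : 0 < L) (Ψ : PeriodicTrialState (n + 1) L)
    (hpos : ∀ X, Ψ.ψ X ≠ 0) {C : ℝ} (hC : 0 ≤ C) (m : Fin 3 → ℤ)
    (h : ∀ t ∈ Set.Icc (0 : ℝ) (1 / 2), tiltedProduct n L Ψ t m ≤ C) :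
    ((n : ℝ) + 1) * levyWeight n L Ψ m * structureFactor n L Ψ m ≤ 2 * C := by
  -- all tilts from the half range
  have hbound : ∀ t ∈ Set.Icc (0 : ℝ) 1, tiltedProduct n L Ψ t m ≤ C := by
    intro t ht
    rcases le_or_gt t (1 / 2) with hle | hgt
    · exact h t ⟨ht.1, hle⟩
    · have hs : 1 - t ∈ Set.Icc (0 : ℝ) (1 / 2) := ⟨by linarith [ht.2], by linarith⟩
      have hrefl : tiltedProduct n L Ψ t m = tiltedProduct n L Ψ (1 - t) m := by
        have := tiltedProduct_one_sub Ψ hL (1 - t) m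
        rw [sub_sub_cancel] at this
        exact this
      rw [hrefl]
      exact h (1 - t) hs
  -- S1: the Lévy weight as a tilt average, with continuity of the profile coefficient
  obtain ⟨hlevy, hcont⟩ := (stub_tiltedLevyIdentity n L hL Ψ hpos).2 m
  have hI : IntervalIntegrable (fun t : ℝ => min t (1 - t) * tiltVarCoeff n L Ψ t m) volume 0 1 := by
    apply ContinuousOn.intervalIntegrable
    rw [Set.uIcc_of_le zero_le_one]
    have hc : Continuous fun t : ℝ => min t (1 - t) :=
      continuous_id.min (continuous_const.sub continuous_id)
    exact hc.continuousOn.mul hcont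
  have key : ((n : ℝ) + 1) * levyWeight n L Ψ m * structureFactor n L Ψ m =
      ∫ t in (0 : ℝ)..1, (-2 * (((n : ℝ) + 1) * structureFactor n L Ψ m)) *
        (min t (1 - t) * tiltVarCoeff n L Ψ t m) := by
    rw [intervalIntegral.integral_const_mul, hlevy]
    ring
  rw [key]
  calc ∫ t in (0 : ℝ)..1, (-2 * (((n : ℝ) + 1) * structureFactor n L Ψ m)) *
          (min t (1 - t) * tiltVarCoeff n L Ψ t m)
      ≤ ∫ t in (0 : ℝ)..1, 2 * C := by
        refine intervalIntegral.integral_mono_on zero_le_one (hI.const_mul _)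
          intervalIntegrable_const fun t ht => ?_
        have hm0 : 0 ≤ min t (1 - t) := le_min ht.1 (by linarith [ht.2])
        have hm1 : min t (1 - t) ≤ 1 / 2 := by
          rcases le_total t (1 / 2) with h' | h'
          · exact (min_le_left _ _).trans h'
          · exact (min_le_right _ _).trans (by linarith)
        have hP : tiltedProduct n L Ψ t m ≤ C := hbound t ht
        have hrw : (-2 * (((n : ℝ) + 1) * structureFactor n L Ψ m)) *
              (min t (1 - t) * tiltVarCoeff n L Ψ t m) = 4 * min t (1 - t) * tiltedProduct n L Ψ t m := by
          unfold tiltedProduct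
          ring
        rw [hrw]
        nlinarith [mul_nonneg hm0 (sub_nonneg.2 hP), mul_nonneg (sub_nonneg.2 hm1) hC]
    _ = 2 * C := by simp

/-! ## Transport of the weakened frames to the crux's weakened frames -/

/-- **`TiltedUncertaintyNearMinimisers → InfraredMinimumUncertaintyNearMinimisers`** (constant `2C`, same
`ρ₀`, same slack `δ`): the pointwise transfer applied inside the near-minimiser frame (the `let`s of the
crux's weakened frame are `coherence`/`levyWeight`/`structureFactor` verbatim). [folklore] -/
theorem nearMinimisers_imu_of_tilted (h : TiltedUncertaintyNearMinimisers) :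
    InfraredMinimumUncertaintyNearMinimisers := by
  intro v h₁ h₂ h₃ h₄
  obtain ⟨C, hC, ρ₀, hρ₀, hB⟩ := h v h₁ h₂ h₃ h₄
  refine ⟨2 * C, by positivity, ρ₀, hρ₀, fun ρ hρ hρρ₀ => ?_⟩
  obtain ⟨δ, hδ, hev⟩ := hB ρ hρ hρρ₀
  refine ⟨δ, hδ, ?_⟩
  filter_upwards [hev] with n hn Ψ
  intro L g ν S hE hfin hreal hpos m hm
  change ((n : ℝ) + 1) * levyWeight n (sideLength ρ (n + 1)) Ψ m *
      structureFactor n (sideLength ρ (n + 1)) Ψ m ≤ 2 * C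
  have hL : 0 < sideLength ρ (n + 1) := by
    unfold sideLength
    exact Real.rpow_pos_of_pos (by positivity) _
  exact mul_levyWeight_mul_structureFactor_le_of_tilted hL Ψ hpos hC m (hn Ψ hE hfin hreal hpos m hm)

/-! ## The two weakened frames are FALSE -/

/-- **THE EIGENSTRUCTURE IS LOAD-BEARING IN S34 (near-minimiser form; registered sub-goal).**  S34's body
for `δ`-near-minimisers without the generator identity is FALSE: it would give the crux for
`δ`-near-minimisers, refuted by the free density waves (`not_infraredMinimumUncertaintyNearMinimisers`:
`v ≡ 0`, `m = e₀`, Bragg peak `S_{e₀} ≍ ε²N` times phase weight `ν_{e₀} ≍ ε²`, `Π ≍ (δL²)² → ∞`). -/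
theorem not_tiltedUncertaintyNearMinimisers : ¬ TiltedUncertaintyNearMinimisers := fun h =>
  not_infraredMinimumUncertaintyNearMinimisers (nearMinimisers_imu_of_tilted h)

/-- **THE EIGENSTRUCTURE IS LOAD-BEARING IN S34.**  S34's body with minimality AND the generator identity
deleted is FALSE (the deleted frame implies the near-minimiser frame). -/
theorem tiltedUncertainty_false_without_eigenstructure : ¬ TiltedUncertaintyWithoutEigenstructure := fun h =>
  not_tiltedUncertaintyNearMinimisers (frameNear_of_frameWithout h)

end Summit.AtomisticToContinuum.BoseEinsteinCondensation.Theorems.InfraredMinimumUncertainty.Negative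

end
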